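import Literature.NumberTheory.Sieve.CFSemigroupHensley
import Literature.NumberTheory.EllipticCurves.ModularCurveGamma0IndexProofs
import HarnessLib

/-!
# Congruence classes of the continued-fractions semigroup: averages and surjectivity

Support file (all results proved) for the named fact
`Literature.NumberTheory.Sieve.MageeOhWinter2019_uniformCounting` (`CFSemigroupCounting.lean`),
which asserts `#{γ ∈ Γ_A : ‖γ‖ ≤ R, γ ≡ ξ (q)} = c R^{2δ_A}/#SL₂(ℤ/q) + O(q^C R^{2δ_A-ε})` for
`(q, Q₀) = 1`. Two elementary structural facts behind this statement ([MageeOhWinter2019, §3,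
"Modular twisting": the constant coefficient of `1_ξ` gives the main term; §2.1/§4: `Γ_A`
generates `SL₂(ℤ/q)` for `q` prime to a fixed modulus]) are proved here:

* `sum_cfCount_eq` — the congruence counts partition the total count:
  `Σ_{ξ ∈ SL₂(ℤ/q)} N_q(ξ, R) = N_1(R)`; hence the main term `c R^{2δ_A}/#SL₂(ℤ/q)` of the fact is
  exactly the AVERAGE of the counts over `ξ` (`avg_cfCount_eq`), each count is `≤ N_1(R)`
  (`cfCount_le_cfCount_one`) and in particular `≤ c₂ R^{2δ_A}` uniformly in `q, ξ`
  (`cfCount_le_uniform`, from Hensley's bound of `CFSemigroupHensley.lean`);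
* `cfSemigroup_map_surjective` — **every residue class is attained**: for `a ≠ b ∈ A` and
  `q ≥ 1` prime to `b - a`, reduction `Γ_A → SL₂(ℤ/qℤ)` is onto (the image is a finite
  semigroup, hence a group; it contains `(g_a g_a)⁻¹ g_a g_b = T^{b-a}` and
  `g_b g_a (g_a g_a)⁻¹ = L^{b-a}`, `T = (1 1; 0 1)`, `L = (1 0; 1 1)`, hence `T`, `L`,
  `S = T⁻¹ L T⁻¹`, hence the image of `SL₂(ℤ) = ⟨S, T⟩`, which is everything by strong
  approximation for `SL₂(ℤ)`). So `Q₀ = |b - a|` is an admissible modulus for the positivity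
  of every congruence count (`cfCount_pos_of_coprime`).

## References

* M. Magee, H. Oh, D. Winter, J. reine angew. Math. 753 (2019) 89–135, §1 (Thm. 1), §3.
  [MageeOhWinter2019]
* G. Shimura, *Introduction to the arithmetic theory of automorphic functions* (1971),
  Lemma 1.38 (`SL₂(ℤ) → SL₂(ℤ/N)` onto). [ShimuraIATAF1971]
-/

noncomputable section

open Filter Set
open scoped Classical MatrixGroups

namespace Literature.NumberTheory.Sieve

variable {A : Finset ℕ}

/-! ### The congruence counts partition the total count -/

/-- Reduction modulo `q` on `SL₂(ℤ)`. [folklore] -/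
abbrev cfRed (q : ℕ) : SL(2, ℤ) →* SL(2, ZMod q) :=
  Matrix.SpecialLinearGroup.map (Int.castRingHom (ZMod q))

/-- The set counted by `cfCount A q ξ R`. [cite: MageeOhWinter2019, §1] -/
def cfBallRes (A : Finset ℕ) (q : ℕ) (ξ : SL(2, ZMod q)) (R : ℝ) : Set SL(2, ℤ) :=
  {γ | (γ : Matrix (Fin 2) (Fin 2) ℤ) ∈ cfSemigroup A ∧
    (∑ i, ∑ j, (((γ : Matrix (Fin 2) (Fin 2) ℤ) i j : ℤ) : ℝ) ^ 2) ≤ R ^ 2 ∧ cfRed q γ = ξ}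

/-- `cfCount A q ξ R = #cfBallRes A q ξ R`. [folklore] -/
theorem cfCount_eq (A : Finset ℕ) (q : ℕ) (ξ : SL(2, ZMod q)) (R : ℝ) :
    cfCount A q ξ R = (cfBallRes A q ξ R).ncard := rfl

/-- The residue-class ball is the part of the full ball reducing to `ξ`. [folklore] -/
theorem cfBallRes_eq (A : Finset ℕ) (q : ℕ) (ξ : SL(2, ZMod q)) (R : ℝ) :
    cfBallRes A q ξ R = cfBall A R ∩ {γ | cfRed q γ = ξ} := by
  ext γ
  simp only [cfBallRes, cfBall, mem_inter_iff, mem_setOf_eq, map_zmod_one_eq_one, and_true, and_assoc]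

/-- `cfCount A q ξ R ≤ cfCount A 1 1 R`. [folklore] -/
theorem cfCount_le_cfCount_one (A : Finset ℕ) (q : ℕ) (ξ : SL(2, ZMod q)) (R : ℝ) :
    cfCount A q ξ R ≤ cfCount A 1 1 R := by
  rw [cfCount_eq, cfCount_one_eq, cfBallRes_eq]
  exact Set.ncard_le_ncard inter_subset_left (cfBall_finite A R)

/-- **The congruence counts partition the total count:**
`Σ_{ξ ∈ SL₂(ℤ/qℤ)} #{γ ∈ Γ_A : ‖γ‖ ≤ R, γ ≡ ξ (q)} = #{γ ∈ Γ_A : ‖γ‖ ≤ R}` (`q ≥ 1`).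
[cite: MageeOhWinter2019, §3] -/
theorem sum_cfCount_eq (A : Finset ℕ) (q : ℕ) [NeZero q] (R : ℝ) :
    ∑ ξ : SL(2, ZMod q), cfCount A q ξ R = cfCount A 1 1 R := by
  have hfin := cfBall_finite A R
  have h1 : ∀ ξ : SL(2, ZMod q), cfCount A q ξ R =
      (hfin.toFinset.filter fun γ => cfRed q γ = ξ).card := by
    intro ξ
    rw [cfCount_eq, cfBallRes_eq, ← Set.ncard_coe_finset]
    congr 1
    ext γ
    simp
  rw [Finset.sum_congr rfl fun ξ _ => h1 ξ, cfCount_one_eq, Set.ncard_eq_toFinset_card _ hfin,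
    Finset.card_eq_sum_card_fiberwise (f := fun γ : SL(2, ℤ) => cfRed q γ) (t := Finset.univ)
      fun _ _ => Finset.mem_univ _]

/-- **The main term is the average:** `(#SL₂(ℤ/q))⁻¹ Σ_ξ N_q(ξ, R) = N_1(R)/#SL₂(ℤ/q)` — the
quantity `c R^{2δ_A}/#SL₂(ℤ/qℤ)` in the fact is (asymptotically) the average congruence count.
[cite: MageeOhWinter2019, §3] -/
theorem avg_cfCount_eq (A : Finset ℕ) (q : ℕ) [NeZero q] (R : ℝ) :
    (∑ ξ : SL(2, ZMod q), (cfCount A q ξ R : ℝ)) / Nat.card (SL(2, ZMod q)) =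
      (cfCount A 1 1 R : ℝ) / Nat.card (SL(2, ZMod q)) := by
  congr 1
  exact_mod_cast sum_cfCount_eq A q R

/-- **Uniform upper bound:** `#{γ ∈ Γ_A : ‖γ‖ ≤ R, γ ≡ ξ (q)} ≤ c₂ R^{2δ_A}` for all `R ≥ 1`,
all `q` and all `ξ` (the trivial bound from Hensley's). [cite: MageeOhWinter2019, Thm. 2] -/
theorem cfCount_le_uniform (hA : ∀ a ∈ A, 1 ≤ a) (h2 : 2 ≤ A.card) :
    ∃ c₂ : ℝ, 0 < c₂ ∧ ∀ (q : ℕ) (ξ : SL(2, ZMod q)) (R : ℝ), 1 ≤ R →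
      (cfCount A q ξ R : ℝ) ≤ c₂ * R ^ (2 * cfDimension A) := by
  obtain ⟨c₂, hc₂, h⟩ := cfCount_one_le hA h2
  refine ⟨c₂, hc₂, fun q ξ R hR => le_trans ?_ (h R hR)⟩
  exact_mod_cast cfCount_le_cfCount_one A q ξ R

/-- Some residue class carries at least the average. [folklore] -/
theorem exists_cfCount_ge_avg (A : Finset ℕ) (q : ℕ) [NeZero q] (R : ℝ) :
    ∃ ξ : SL(2, ZMod q), (cfCount A 1 1 R : ℝ) / Nat.card (SL(2, ZMod q)) ≤ cfCount A q ξ R := by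
  by_contra h
  push Not at h
  have hcard : (0 : ℝ) < Nat.card (SL(2, ZMod q)) := by
    rw [Nat.card_eq_fintype_card]
    exact_mod_cast Fintype.card_pos
  have hsum : ∑ ξ : SL(2, ZMod q), (cfCount A q ξ R : ℝ) <
      ∑ _ξ : SL(2, ZMod q), (cfCount A 1 1 R : ℝ) / Nat.card (SL(2, ZMod q)) :=
    Finset.sum_lt_sum_of_nonempty Finset.univ_nonempty fun ξ _ => h ξ
  rw [Finset.sum_const, Finset.card_univ, nsmul_eq_mul, ← Nat.card_eq_fintype_card,
    mul_div_cancel₀ _ hcard.ne'] at hsum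
  have := sum_cfCount_eq A q R
  have : (∑ ξ : SL(2, ZMod q), (cfCount A q ξ R : ℝ)) = cfCount A 1 1 R := by exact_mod_cast this
  linarith

/-! ### Every residue class is attained: `Γ_A → SL₂(ℤ/qℤ)` is onto for `(q, b - a) = 1` -/

/-- The generator `g_a` as an element of `GL₂(ℤ)`-with-inverse: `g_a⁻¹ = (-a 1; 1 0)` as integer
matrices (`g_a g_a⁻¹ = 1`). [folklore] -/
theorem cfGen_mul_inv (a : ℕ) : cfGen a * !![-(a : ℤ), 1; 1, 0] = 1 := by
  ext i j
  fin_cases i <;> fin_cases j <;> simp [cfGen, Matrix.mul_apply, Fin.sum_univ_two]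

/-- `g_a⁻¹ g_b = T^{b-a}` as integer matrices: `(-a 1; 1 0)(0 1; 1 b) = (1 b-a; 0 1)`. [folklore] -/
theorem cfGen_inv_mul_cfGen (a b : ℕ) :
    !![-(a : ℤ), 1; 1, 0] * cfGen b = !![1, (b : ℤ) - a; 0, 1] := by
  ext i j
  fin_cases i <;> fin_cases j <;> simp [cfGen, Matrix.mul_apply, Fin.sum_univ_two, neg_add_eq_sub]

/-- `g_b g_a⁻¹ = L^{b-a}`: `(0 1; 1 b)(-a 1; 1 0) = (1 0; b-a 1)`. [folklore] -/
theorem cfGen_mul_cfGen_inv (a b : ℕ) :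
    cfGen b * !![-(a : ℤ), 1; 1, 0] = !![1, 0; (b : ℤ) - a, 1] := by
  ext i j
  fin_cases i <;> fin_cases j <;> simp [cfGen, Matrix.mul_apply, Fin.sum_univ_two, neg_add_eq_sub]

/-- The element `g_a g_b ∈ Γ_A` as an element of `SL₂(ℤ)`. [folklore] -/
def cfPair (a b : ℕ) : SL(2, ℤ) :=
  ⟨cfGen a * cfGen b, by rw [Matrix.det_mul, det_cfGen, det_cfGen]; norm_num⟩

/-- `g_a g_b ∈ Γ_A` for `a, b ∈ A`. [folklore] -/
theorem cfPair_mem {a b : ℕ} (ha : a ∈ A) (hb : b ∈ A) :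
    ((cfPair a b : SL(2, ℤ)) : Matrix (Fin 2) (Fin 2) ℤ) ∈ cfSemigroup A :=
  cfGen_mul_cfGen_mem ha hb

/-- The upper unipotent `T^{d}` (`d = b - a`) realised in `Γ_A Γ_A⁻¹`:
`(g_a g_a)⁻¹ (g_a g_b) = (1 b-a; 0 1)`. [folklore] -/
theorem cfPair_inv_mul (a b : ℕ) :
    (((cfPair a a)⁻¹ * cfPair a b : SL(2, ℤ)) : Matrix (Fin 2) (Fin 2) ℤ) = !![1, (b : ℤ) - a; 0, 1] := by
  have hinv : (((cfPair a a)⁻¹ : SL(2, ℤ)) : Matrix (Fin 2) (Fin 2) ℤ) =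
      !![-(a : ℤ), 1; 1, 0] * !![-(a : ℤ), 1; 1, 0] := by
    rw [Matrix.SpecialLinearGroup.coe_inv]
    show Matrix.adjugate (cfGen a * cfGen a) = _
    ext i j
    fin_cases i <;> fin_cases j <;>
      simp [Matrix.adjugate_fin_two, cfGen, Matrix.mul_apply, Fin.sum_univ_two, add_comm]
  rw [Matrix.SpecialLinearGroup.coe_mul, hinv]
  show !![-(a : ℤ), 1; 1, 0] * !![-(a : ℤ), 1; 1, 0] * (cfGen a * cfGen b) = _
  rw [Matrix.mul_assoc, ← Matrix.mul_assoc (!![-(a : ℤ), 1; 1, 0]) (cfGen a),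
    show !![-(a : ℤ), 1; 1, 0] * cfGen a = 1 from by
      ext i j; fin_cases i <;> fin_cases j <;> simp [cfGen, Matrix.mul_apply, Fin.sum_univ_two],
    Matrix.one_mul, cfGen_inv_mul_cfGen]

/-- The lower unipotent `L^{d}` realised in `Γ_A Γ_A⁻¹`:
`(g_b g_a) (g_a g_a)⁻¹ = (1 0; b-a 1)`. [folklore] -/
theorem cfPair_mul_inv (a b : ℕ) :
    ((cfPair b a * (cfPair a a)⁻¹ : SL(2, ℤ)) : Matrix (Fin 2) (Fin 2) ℤ) = !![1, 0; (b : ℤ) - a, 1] := by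
  have hinv : (((cfPair a a)⁻¹ : SL(2, ℤ)) : Matrix (Fin 2) (Fin 2) ℤ) =
      !![-(a : ℤ), 1; 1, 0] * !![-(a : ℤ), 1; 1, 0] := by
    rw [Matrix.SpecialLinearGroup.coe_inv]
    show Matrix.adjugate (cfGen a * cfGen a) = _
    ext i j
    fin_cases i <;> fin_cases j <;>
      simp [Matrix.adjugate_fin_two, cfGen, Matrix.mul_apply, Fin.sum_univ_two, add_comm]
  rw [Matrix.SpecialLinearGroup.coe_mul, hinv]
  show cfGen b * cfGen a * (!![-(a : ℤ), 1; 1, 0] * !![-(a : ℤ), 1; 1, 0]) = _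
  rw [← Matrix.mul_assoc, Matrix.mul_assoc (cfGen b), cfGen_mul_inv, Matrix.mul_one,
    cfGen_mul_cfGen_inv]

/-- The upper unipotent `(1 x; 0 1) ∈ SL₂(ℤ/qℤ)`. [folklore] -/
def cfUpper {q : ℕ} (x : ZMod q) : SL(2, ZMod q) := ⟨!![1, x; 0, 1], by simp [Matrix.det_fin_two_of]⟩

/-- The lower unipotent `(1 0; x 1) ∈ SL₂(ℤ/qℤ)`. [folklore] -/
def cfLower {q : ℕ} (x : ZMod q) : SL(2, ZMod q) := ⟨!![1, 0; x, 1], by simp [Matrix.det_fin_two_of]⟩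

/-- `x ↦ (1 x; 0 1)` is a homomorphism from the additive group. [folklore] -/
def cfUpperHom (q : ℕ) : Multiplicative (ZMod q) →* SL(2, ZMod q) where
  toFun y := cfUpper y.toAdd
  map_one' := by ext i j; fin_cases i <;> fin_cases j <;> simp [cfUpper]
  map_mul' y z := by
    ext i j
    fin_cases i <;> fin_cases j <;> simp [cfUpper, Matrix.mul_apply, Fin.sum_univ_two, add_comm]

/-- `x ↦ (1 0; x 1)` is a homomorphism from the additive group. [folklore] -/
def cfLowerHom (q : ℕ) : Multiplicative (ZMod q) →* SL(2, ZMod q) where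
  toFun y := cfLower y.toAdd
  map_one' := by ext i j; fin_cases i <;> fin_cases j <;> simp [cfLower]
  map_mul' y z := by
    ext i j
    fin_cases i <;> fin_cases j <;> simp [cfLower, Matrix.mul_apply, Fin.sum_univ_two, add_comm]

/-- Powers of unipotents: `(1 x; 0 1)^n = (1 nx; 0 1)`. [folklore] -/
theorem cfUpper_zpow {q : ℕ} (x : ZMod q) (n : ℤ) : cfUpper x ^ n = cfUpper ((n : ZMod q) * x) := by
  have h := map_zpow (cfUpperHom q) (Multiplicative.ofAdd x) n
  have e1 : cfUpperHom q (Multiplicative.ofAdd x) = cfUpper x := rfl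
  have e2 : cfUpperHom q ((Multiplicative.ofAdd x) ^ n) = cfUpper ((n : ZMod q) * x) := by
    show cfUpper ((Multiplicative.ofAdd x) ^ n).toAdd = _
    rw [← ofAdd_zsmul, toAdd_ofAdd, zsmul_eq_mul]
  rw [← e1, ← h, e2]

/-- Powers of unipotents: `(1 0; x 1)^n = (1 0; nx 1)`. [folklore] -/
theorem cfLower_zpow {q : ℕ} (x : ZMod q) (n : ℤ) : cfLower x ^ n = cfLower ((n : ZMod q) * x) := by
  have h := map_zpow (cfLowerHom q) (Multiplicative.ofAdd x) n
  have e1 : cfLowerHom q (Multiplicative.ofAdd x) = cfLower x := rfl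
  have e2 : cfLowerHom q ((Multiplicative.ofAdd x) ^ n) = cfLower ((n : ZMod q) * x) := by
    show cfLower ((Multiplicative.ofAdd x) ^ n).toAdd = _
    rw [← ofAdd_zsmul, toAdd_ofAdd, zsmul_eq_mul]
  rw [← e1, ← h, e2]

/-- The image of `Γ_A` in `SL₂(ℤ/qℤ)`. [folklore] -/
def cfImage (A : Finset ℕ) (q : ℕ) : Set SL(2, ZMod q) :=
  {ξ | ∃ γ : SL(2, ℤ), (γ : Matrix (Fin 2) (Fin 2) ℤ) ∈ cfSemigroup A ∧ cfRed q γ = ξ}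

/-- The image is closed under multiplication. [folklore] -/
theorem mul_mem_cfImage {q : ℕ} {ξ η : SL(2, ZMod q)} (hξ : ξ ∈ cfImage A q) (hη : η ∈ cfImage A q) :
    ξ * η ∈ cfImage A q := by
  obtain ⟨γ, hγ, rfl⟩ := hξ
  obtain ⟨γ', hγ', rfl⟩ := hη
  exact ⟨γ * γ', by rw [Matrix.SpecialLinearGroup.coe_mul]; exact mul_mem_cfSemigroup hγ hγ',
    map_mul _ _ _⟩

/-- Positive powers stay in the image. [folklore] -/
theorem pow_mem_cfImage {q : ℕ} {ξ : SL(2, ZMod q)} (hξ : ξ ∈ cfImage A q) {n : ℕ} (hn : 0 < n) :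
    ξ ^ n ∈ cfImage A q := by
  induction n with
  | zero => exact absurd hn (lt_irrefl 0)
  | succ n ih =>
      rcases Nat.eq_zero_or_pos n with rfl | hn'
      · simpa using hξ
      · rw [pow_succ]
        exact mul_mem_cfImage (ih hn') hξ

/-- **A finite semigroup in a group is a group:** the image of `Γ_A` in the finite group
`SL₂(ℤ/qℤ)` (`q ≥ 1`) is a subgroup. [folklore] -/
def cfImageSubgroup (A : Finset ℕ) (hne : A.Nonempty) (q : ℕ) [NeZero q] : Subgroup SL(2, ZMod q) where
  carrier := cfImage A q
  mul_mem' := mul_mem_cfImage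
  one_mem' := by
    obtain ⟨a, ha⟩ := hne
    have hξ : cfRed q (cfPair a a) ∈ cfImage A q := ⟨cfPair a a, cfPair_mem ha ha, rfl⟩
    have h := pow_mem_cfImage hξ (orderOf_pos (cfRed q (cfPair a a)))
    rwa [pow_orderOf_eq_one] at h
  inv_mem' := by
    intro ξ hξ
    have hord := orderOf_pos ξ
    rcases Nat.lt_or_ge 1 (orderOf ξ) with hlt | hle
    · have h := pow_mem_cfImage hξ (Nat.sub_pos_of_lt hlt)
      have heq : ξ ^ (orderOf ξ - 1) = ξ⁻¹ := by
        rw [eq_inv_iff_mul_eq_one, ← pow_succ, Nat.sub_add_cancel hlt.le, pow_orderOf_eq_one]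
      rwa [heq] at h
    · have h1 : orderOf ξ = 1 := le_antisymm hle hord
      rw [orderOf_eq_one_iff] at h1
      subst h1
      simpa using hξ

/-- **`Γ_A → SL₂(ℤ/qℤ)` is onto for `(q, b - a) = 1`:** for `a ≠ b` in `A` and `q ≥ 1` with
`q` prime to `b - a`, every `ξ ∈ SL₂(ℤ/qℤ)` is the reduction of an element of `Γ_A`
(the image is a subgroup containing `T^{b-a}` and `L^{b-a}`, hence `T`, `L`, `S = T⁻¹ L T⁻¹`,
hence the reduction of `⟨S, T⟩ = SL₂(ℤ)`, which is everything by `SL₂(ℤ) ↠ SL₂(ℤ/qℤ)`).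
[cite: MageeOhWinter2019, Thm. 1 (the modulus `Q₀`)] -/
theorem cfSemigroup_map_surjective {a b : ℕ} (ha : a ∈ A) (hb : b ∈ A) {q : ℕ} [NeZero q]
    (hq : IsCoprime ((b : ℤ) - a) q) (ξ : SL(2, ZMod q)) :
    ∃ γ : SL(2, ℤ), (γ : Matrix (Fin 2) (Fin 2) ℤ) ∈ cfSemigroup A ∧ cfRed q γ = ξ := by
  have hne : A.Nonempty := ⟨a, ha⟩
  set H := cfImageSubgroup A hne q with hH
  suffices htop : H = ⊤ by
    have : ξ ∈ H := by rw [htop]; exact Subgroup.mem_top ξ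
    exact this
  -- `T^{d}`, `L^{d}` reduced, `d = b - a`, lie in `H`
  set d : ℤ := (b : ℤ) - a with hd
  have hTd : cfRed q ((cfPair a a)⁻¹ * cfPair a b) ∈ H := by
    rw [map_mul, map_inv]
    exact H.mul_mem (H.inv_mem ⟨_, cfPair_mem ha ha, rfl⟩) ⟨_, cfPair_mem ha hb, rfl⟩
  have hLd : cfRed q (cfPair b a * (cfPair a a)⁻¹) ∈ H := by
    rw [map_mul, map_inv]
    exact H.mul_mem ⟨_, cfPair_mem hb ha, rfl⟩ (H.inv_mem ⟨_, cfPair_mem ha ha, rfl⟩)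
  -- as explicit unipotents in `SL₂(ℤ/q)`
  have eTd : cfRed q ((cfPair a a)⁻¹ * cfPair a b) = cfUpper (d : ZMod q) := by
    apply Subtype.ext
    show (Int.castRingHom (ZMod q)).mapMatrix (((cfPair a a)⁻¹ * cfPair a b : SL(2, ℤ)) :
      Matrix (Fin 2) (Fin 2) ℤ) = !![1, (d : ZMod q); 0, 1]
    rw [cfPair_inv_mul]
    ext i j
    fin_cases i <;> fin_cases j <;> simp [hd]
  have eLd : cfRed q (cfPair b a * (cfPair a a)⁻¹) = cfLower (d : ZMod q) := by
    apply Subtype.ext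
    show (Int.castRingHom (ZMod q)).mapMatrix ((cfPair b a * (cfPair a a)⁻¹ : SL(2, ℤ)) :
      Matrix (Fin 2) (Fin 2) ℤ) = !![1, 0; (d : ZMod q), 1]
    rw [cfPair_mul_inv]
    ext i j
    fin_cases i <;> fin_cases j <;> simp [hd]
  rw [eTd] at hTd
  rw [eLd] at hLd
  -- `d` is a unit mod `q`: `u d + v q = 1`
  obtain ⟨u, v, huv⟩ := hq
  have hud : (u : ZMod q) * (d : ZMod q) = 1 := by
    have h := congrArg (fun z : ℤ => (z : ZMod q)) huv
    simp only [Int.cast_add, Int.cast_mul, Int.cast_natCast, ZMod.natCast_self, mul_zero, add_zero,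
      Int.cast_one] at h
    exact h
  -- hence `T`, `L` reduced lie in `H`
  have hT : cfUpper (1 : ZMod q) ∈ H := by
    have h := H.zpow_mem hTd u
    rwa [cfUpper_zpow, hud] at h
  have hL : cfLower (1 : ZMod q) ∈ H := by
    have h := H.zpow_mem hLd u
    rwa [cfLower_zpow, hud] at h
  -- and `S = T⁻¹ L T⁻¹`
  have hTred : cfRed q ModularGroup.T = cfUpper (1 : ZMod q) := by
    apply Subtype.ext
    show (Int.castRingHom (ZMod q)).mapMatrix ((ModularGroup.T : SL(2, ℤ)) : Matrix (Fin 2) (Fin 2) ℤ) =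
      !![1, (1 : ZMod q); 0, 1]
    rw [ModularGroup.coe_T]
    ext i j
    fin_cases i <;> fin_cases j <;> simp
  have hSred : cfRed q ModularGroup.S =
      (cfUpper (1 : ZMod q))⁻¹ * cfLower 1 * (cfUpper (1 : ZMod q))⁻¹ := by
    apply Subtype.ext
    rw [Matrix.SpecialLinearGroup.coe_mul, Matrix.SpecialLinearGroup.coe_mul,
      Matrix.SpecialLinearGroup.coe_inv]
    show (Int.castRingHom (ZMod q)).mapMatrix ((ModularGroup.S : SL(2, ℤ)) : Matrix (Fin 2) (Fin 2) ℤ) =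
      Matrix.adjugate !![1, (1 : ZMod q); 0, 1] * !![1, 0; (1 : ZMod q), 1] *
        Matrix.adjugate !![1, (1 : ZMod q); 0, 1]
    rw [ModularGroup.coe_S]
    ext i j
    fin_cases i <;> fin_cases j <;>
      simp [Matrix.adjugate_fin_two, Matrix.mul_apply, Fin.sum_univ_two]
  have hS : cfRed q ModularGroup.S ∈ H := by
    rw [hSred]
    exact H.mul_mem (H.mul_mem (H.inv_mem hT) hL) (H.inv_mem hT)
  have hT' : cfRed q ModularGroup.T ∈ H := by rw [hTred]; exact hT
  -- the reduction of `SL₂(ℤ) = ⟨S, T⟩` lies in `H`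
  have hclos : (⊤ : Subgroup SL(2, ℤ)) ≤ H.comap (cfRed q) := by
    rw [← SpecialLinearGroup.SL2Z_generators, Subgroup.closure_le]
    rintro γ (rfl | rfl)
    · exact hS
    · exact hT'
  -- and the reduction is onto
  rw [eq_top_iff]
  intro ξ _
  obtain ⟨γ, rfl⟩ :=
    Literature.NumberTheory.EllipticCurves.ModularForms.specialLinearGroup_map_surjective q ξ
  exact hclos (Subgroup.mem_top γ)

/-- **Every congruence count is eventually positive** for moduli prime to `Q₀ = b - a`
(`a ≠ b ∈ A`): for `(q, b - a) = 1` and every `ξ ∈ SL₂(ℤ/qℤ)` there is `R₀` with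
`cfCount A q ξ R ≥ 1` for all `R ≥ R₀`. [cite: MageeOhWinter2019, Thm. 1] -/
theorem cfCount_pos_of_coprime {a b : ℕ} (ha : a ∈ A) (hb : b ∈ A) {q : ℕ} [NeZero q]
    (hq : IsCoprime ((b : ℤ) - a) q) (ξ : SL(2, ZMod q)) :
    ∃ R₀ : ℝ, ∀ R : ℝ, R₀ ≤ R → 1 ≤ cfCount A q ξ R := by
  obtain ⟨γ, hγ, hred⟩ := cfSemigroup_map_surjective ha hb hq ξ
  refine ⟨Real.sqrt (∑ i, ∑ j, (((γ : Matrix (Fin 2) (Fin 2) ℤ) i j : ℤ) : ℝ) ^ 2), fun R hR => ?_⟩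
  rw [cfCount_eq]
  have hmem : γ ∈ cfBallRes A q ξ R := by
    refine ⟨hγ, ?_, hred⟩
    have h0 : 0 ≤ ∑ i, ∑ j, (((γ : Matrix (Fin 2) (Fin 2) ℤ) i j : ℤ) : ℝ) ^ 2 :=
      Finset.sum_nonneg fun _ _ => Finset.sum_nonneg fun _ _ => sq_nonneg _
    have hR0 : 0 ≤ R := (Real.sqrt_nonneg _).trans hR
    calc ∑ i, ∑ j, (((γ : Matrix (Fin 2) (Fin 2) ℤ) i j : ℤ) : ℝ) ^ 2
        = (Real.sqrt (∑ i, ∑ j, (((γ : Matrix (Fin 2) (Fin 2) ℤ) i j : ℤ) : ℝ) ^ 2)) ^ 2 :=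
          (Real.sq_sqrt h0).symm
      _ ≤ R ^ 2 := pow_le_pow_left₀ (Real.sqrt_nonneg _) hR 2
  have hfin : (cfBallRes A q ξ R).Finite := by
    rw [cfBallRes_eq]
    exact (cfBall_finite A R).subset inter_subset_left
  exact (Set.ncard_pos hfin).2 ⟨γ, hmem⟩


/-! ### What is proved of the fact, assembled -/

/-- **The proved skeleton of `MageeOhWinter2019_uniformCounting`.** For every finite `A ⊆ ℕ_{≥1}`
with `#A ≥ 2`: `δ_A > 0`, and there are `Q₀ > 0` (namely `b - a` for two letters `a < b` of `A`)
and `c₁, c₂, R₀ > 0` such that for every `q ≥ 1` prime to `Q₀`: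
(i) every congruence count is `≤ c₂ R^{2δ_A}` (`R ≥ 1`), uniformly in `q` and `ξ`;
(ii) the counts sum over `ξ ∈ SL₂(ℤ/qℤ)` to the total count, which is `≍ R^{2δ_A}` (`R ≥ R₀`) —
so their average is `≍ R^{2δ_A}/#SL₂(ℤ/qℤ)`, the shape of the main term;
(iii) every residue class `ξ` is attained: its count is `≥ 1` for `R` large.
What the fact asserts beyond this — that EACH count is asymptotic to the average with a uniform
power saving — is the spectral/expansion content of [MageeOhWinter2019] (Thm. 4, Thm. 11).
[cite: MageeOhWinter2019, Thm. 1, Thm. 2, Thm. 11] -/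
theorem MageeOhWinter2019_uniformCounting_skeleton (A : Finset ℕ) (hA : ∀ a ∈ A, 1 ≤ a)
    (h2 : 2 ≤ A.card) :
    0 < cfDimension A ∧
    ∃ Q₀ : ℕ, 0 < Q₀ ∧ ∃ c₁ : ℝ, 0 < c₁ ∧ ∃ c₂ : ℝ, 0 < c₂ ∧ ∃ R₀ : ℝ, 0 < R₀ ∧
      ∀ q : ℕ, 0 < q → Nat.Coprime q Q₀ →
        (∀ (ξ : SL(2, ZMod q)) (R : ℝ), 1 ≤ R →
          (cfCount A q ξ R : ℝ) ≤ c₂ * R ^ (2 * cfDimension A)) ∧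
        (∀ R : ℝ, R₀ ≤ R →
          c₁ * R ^ (2 * cfDimension A) ≤ ∑ᶠ ξ : SL(2, ZMod q), (cfCount A q ξ R : ℝ) ∧
            ∑ᶠ ξ : SL(2, ZMod q), (cfCount A q ξ R : ℝ) ≤ c₂ * R ^ (2 * cfDimension A)) ∧
        ∀ ξ : SL(2, ZMod q), ∃ R₁ : ℝ, ∀ R : ℝ, R₁ ≤ R → 1 ≤ cfCount A q ξ R := by
  refine ⟨cfDimension_pos hA h2, ?_⟩
  -- two distinct letters `a < b`
  obtain ⟨a, ha, b, hb, hab⟩ : ∃ a ∈ A, ∃ b ∈ A, a < b := by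
    have hne := nonempty_of_two_le_card h2
    obtain ⟨b, hb, hne'⟩ := Finset.exists_mem_ne (by omega : 1 < A.card) (A.min' hne)
    exact ⟨A.min' hne, A.min'_mem hne, b, hb, lt_of_le_of_ne (A.min'_le b hb) hne'.symm⟩
  obtain ⟨c₂, hc₂, hup⟩ := cfCount_le_uniform hA h2
  obtain ⟨R₀, hR₀, c₁, hc₁, c₂', hc₂', hboth⟩ := cfCount_one_asymp hA h2
  refine ⟨b - a, Nat.sub_pos_of_lt hab, c₁, hc₁, max c₂ c₂', lt_max_of_lt_left hc₂, R₀, hR₀,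
    fun q hq hcop => ?_⟩
  haveI : NeZero q := ⟨hq.ne'⟩
  have hcopZ : IsCoprime ((b : ℤ) - a) q := by
    have h := (Nat.coprime_comm.1 hcop)
    rw [← Nat.cast_sub hab.le]
    exact Int.isCoprime_iff_gcd_eq_one.2 (by simpa [Int.gcd_natCast_natCast] using h)
  refine ⟨fun ξ R hR => (hup q ξ R hR).trans ?_, fun R hR => ?_, fun ξ => cfCount_pos_of_coprime ha hb hcopZ ξ⟩
  · exact mul_le_mul_of_nonneg_right (le_max_left _ _) (by positivity)
  · have hsum : ∑ᶠ ξ : SL(2, ZMod q), (cfCount A q ξ R : ℝ) = cfCount A 1 1 R := by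
      rw [finsum_eq_sum_of_fintype]
      exact_mod_cast sum_cfCount_eq A q R
    rw [hsum]
    obtain ⟨hl, hu⟩ := hboth R hR
    have hR0 : 0 ≤ R := hR₀.le.trans hR
    exact ⟨hl, hu.trans (mul_le_mul_of_nonneg_right (le_max_right _ _) (by positivity))⟩

end Literature.NumberTheory.Sieve
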